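/-
Origin: expansion seat `prover-pub-hodgecm-mc-sinst-1-g3-0`, handover #1207 2026-08-20T04:33Z md5 b20082f79b4f (528 l.) NEW additive drop-alone leaf — CONDITIONAL on the K-1 twin `Vendored/H21/NumberTheory/Automorphic/UnitaryLineArchExponents` (+ SeesawTorus, SeesawTorusCharacters); (J-μ) S-side read-off: slotType/nWOf, hμ₀ by construction, hμ₁₂₃ ⟺ Δ-identities; install AFTER glue-2 K-1 v33 #K357 #K358 #K359; drop alone on bounce; NAME LIST: HodgeCM.Model.ArchSideTerm.hμ₀_of_χOfType · HodgeCM.Model.ArchSideTerm.hμ₁_iff_sub · HodgeCM.Model.ArchSideTerm.hμ₀_iff_archType) (`HOME/mc/pub-hodgecm-mc-sinst-1-g3/stage/HodgeCM/Model/ArchLineSlotType.lean`, md5 b20082f79b4f, 528 lines);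
landed by the gen-15 packager (p-g15) in gate run 41 as `HodgeCM/Model/ArchLineSlotType.lean` (verbatim).
-/
/-
Origin: speedrun cell pub-hodgecm, MODEL-CONSTRUCTION sub-cell, lineage mc-sinst-1 (S-instance constructor, BINDER-OWNERS row 5 `S`),
seat prover-pub-hodgecm-mc-sinst-1-g3-0 (gen 3), 2026-08-20.  Target in PKG: `HodgeCM/Model/ArchLineSlotType.lean`
(NEW additive drop-alone leaf; RUN 41+ material; imports the installed RUN-39 leaf `Model/ArchLineDatumOf` (theta-3 (F1)), the installed RUN-38
leaf `Model/ThetaAdelicSideEta` (sinst-1 #1204) and ONE new K-1 twin `Vendored/…/Automorphic/UnitaryLineArchExponents` (+ its two-file import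
chain `SeesawTorus`, `SeesawTorusCharacters`)).  KERNEL only: 0 records / named facts / cites, 0 proof holes; intended closure {propext, Classical.choice, Quot.sound}.
-/
import Summits.HodgeConjecture.HodgeCM.Model.ArchLineDatumOf_3
import Summits.HodgeConjecture.HodgeCM.Model.ThetaAdelicSideEta
import Literature.NumberTheory.Automorphic.UnitaryLineArchExponents

/-!
# (J-μ) as integer identities: the archimedean TYPES of the four line slots of the S pin (the S-side read-off)

The four fields `hμₖ` of `ArchSideTerm.ArchLineDatum` (theta-3 (E1) `Model/ArchLineInputOf`) — the hypotheses of (F1)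
`archLineDatumOf … (hμ₀ hμ₁ hμ₂ hμ₃)` — read, for each slot `k`,

  `∀ t, ηₖ(1, u_t) · χₖ(1, u_t · 1_{Wₖ}) · cₖ(t) = archWeight L (μ k) t`     (`u_t = (cmAdelicOneEquivRelNormOne L).symm (relNormOneInfToIdeles t)`)

with `χₖ` the see-saw discrepancy characters `cmLineChar₀/₁`, `cmConjLineChar₀/₁` of the CHOSEN splittings and `cₖ` the centre eigen-character of
the pinned archimedean vector (today (F1)'s `lineC`; any continuous character in this file).  Every continuous character of the archimedean torus
`U(1)(L⁺ ⊗ ℝ) = ∏_w U(1)` is `archWeight L m` for a unique `m` ([BrockerTomDieck1985, II (8.1)/(8.2)]; tree `UnitaryLineArchExponents.charArchType`),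
so each `hμₖ` is an identity of INTEGER VECTORS.  This file (sinst-1-g2's analysis `ETA-S-NORM.md` (C1)–(C3), kernel form):

* §1 generic: `infUnitToOne` (`t ↦ u_t` as a continuous hom), `charArchType_mul'` (types add), `unitaryLineCharInf χ` (an automorphic
  `χ : [U(1)] → U(1)` read on the archimedean torus) with `unitaryLineCharInf_eq_archWeight : … = archWeight L (archType L χ)`,
  `forall_mul_eq_archWeight_iff` (`(∀ t, ψ t · c t = archWeight m t) ↔ charArchType (ψ·c) = m`);
* §2 the slots: `etaInfₖ η` (`t ↦ ηₖ(1,u_t)`), `slotChiₖ` (`t ↦ χₖ(1, u_t·1_{Wₖ})`), `lineCHom` (`lineC` as a hom), and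
  **`hμₖ_iff_charArchType`**: `hμₖ ↔ charArchType (etaInfₖ η) + charArchType (slotChiₖ · c) = μ k`;
* §3 at the Stage-B η of #1204 (`EtaChi.η @χV @χW`, `eta_one_apply`): `etaInf_eq_unitaryLineCharInf`, hence
  **`hμₖ_iff_archType`**: `hμₖ ↔ UnitaryLineChar.archType (χW V c) + slotTypeₖ = μ c k` with the READ-OFF
  **`slotTypeₖ V c … := charArchType (slotChiₖ · c)`**; the slot-0 normalisation **`nWOf`** (`:= μ c 0 − slotType₀`, under the continuity guard,
  `0` otherwise) with **`hμ₀_of_nWOf`**: at `χW := EtaChi.χOfType @(nWOf …)` the field `hμ₀` HOLDS; and for every slot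
  **`hμₖ_iff_sub`**: given `archType (χW V c) = μ c 0 − slotType₀`, `hμₖ ↔ slotTypeₖ − slotType₀ = μ c k − μ c 0` — the three
  integer tables `Δₖ` that binder-2's `placeVacExponents`/`vacScalar` closed forms and theta's `lineCenterChar` closed form are to hit.

Continuity of the discrepancy pull-backs `slotChiₖ` is an INPUT here (it follows from the installed CM-lines majorant twins under plane-definiteness at
`ι₁`; not re-derived in this leaf).  Nothing here is a claim of PerL/QW8; nothing is cited as a fact.
-/

set_option autoImplicit false

noncomputable section

open scoped Matrix Classical
open Literature.NumberTheory.Automorphic Literature.NumberTheory.Weil1964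
open Literature.NumberTheory.GelbartRogawski1991.UnitaryDualPair
open HodgeCM.Adelic HodgeCM.PerL34

namespace HodgeCM.Model.ArchSideTerm

/-! ## §1 Generic: characters of the archimedean torus and their types -/

section Generic

variable (L : Type) [Field L] [NumberField L] [NumberField.IsCMField L]

/-- **`t ↦ u_t`**: the archimedean torus `U(1)(L⁺ ⊗ ℝ)` into `U(1)(𝔸_{L⁺})`, in the spelling of (E1)/(F1)
(`(cmAdelicOneEquivRelNormOne L).symm (relNormOneInfToIdeles t)`), as a homomorphism. -/
def infUnitToOne : ↥(relNormOneInfUnits (↥(NumberField.maximalRealSubfield L)) L) →* CMAdelicOne L :=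
  (UnitaryGroup.cmAdelicOneEquivRelNormOne L).symm.toMonoidHom.comp (relNormOneInfToIdeles (↥(NumberField.maximalRealSubfield L)) L)

/-- formula (definitional). -/
theorem infUnitToOne_apply (t : ↥(relNormOneInfUnits (↥(NumberField.maximalRealSubfield L)) L)) :
    infUnitToOne L t = (UnitaryGroup.cmAdelicOneEquivRelNormOne L).symm (relNormOneInfToIdeles (↥(NumberField.maximalRealSubfield L)) L t) :=
  rfl

/-- `t ↦ u_t` is continuous. -/
theorem continuous_infUnitToOne : Continuous (infUnitToOne L) :=
  (continuous_cmAdelicOneEquivRelNormOne_symm L).comp (continuous_relNormOneInfToIdeles (↥(NumberField.maximalRealSubfield L)) L)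

/-- **types add**: `charArchType (f · g) = charArchType f + charArchType g`. -/
theorem charArchType_mul' (f g : ↥(relNormOneInfUnits (↥(NumberField.maximalRealSubfield L)) L) →* ℂ) (hf : Continuous f) (hg : Continuous g)
    (hfg : Continuous ⇑(f * g)) :
    charArchType L (f * g) hfg = charArchType L f hf + charArchType L g hg := by
  rw [charArchType_eq_iff]
  ext t
  rw [archWeight_add, MonoidHom.mul_apply, ← charArchType_spec, ← charArchType_spec]

omit [NumberField.IsCMField L] in
/-- a continuous `f · g`. -/
theorem continuous_mul_hom {f g : ↥(relNormOneInfUnits (↥(NumberField.maximalRealSubfield L)) L) →* ℂ} (hf : Continuous f) (hg : Continuous g) :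
    Continuous ⇑(f * g) :=
  hf.mul hg

/-- **`(∀ t, ψ t · c t = archWeight m t) ↔ charArchType (ψ · c) = m`** — a (J-μ)-shaped identity IS an identity of integer vectors. -/
theorem forall_mul_eq_archWeight_iff (ψ c : ↥(relNormOneInfUnits (↥(NumberField.maximalRealSubfield L)) L) →* ℂ)
    (hψc : Continuous ⇑(ψ * c)) (m : NumberField.InfinitePlace L → ℤ) :
    (∀ t, ψ t * c t = archWeight L m t) ↔ charArchType L (ψ * c) hψc = m := by
  rw [charArchType_eq_iff]
  constructor
  · intro h
    ext t
    rw [MonoidHom.mul_apply]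
    exact (h t).symm
  · intro h t
    rw [← MonoidHom.mul_apply, ← h]

/-- an automorphic character `χ : [U(1)] → U(1)` READ on the archimedean torus: `t ↦ χ[u_t]` (E's spelling `charOfUnitaryLineChar χ u_t`). -/
def unitaryLineCharInf
    (χ : ContinuousMonoidHom (relNormOneIdeles (↥(NumberField.maximalRealSubfield L)) L ⧸ relNormOneRat (↥(NumberField.maximalRealSubfield L)) L) Circle) :
    ↥(relNormOneInfUnits (↥(NumberField.maximalRealSubfield L)) L) →* ℂ :=
  (Units.coeHom ℂ).comp ((charOfUnitaryLineChar L χ).comp (infUnitToOne L))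

/-- formula (definitional). -/
theorem unitaryLineCharInf_apply
    (χ : ContinuousMonoidHom (relNormOneIdeles (↥(NumberField.maximalRealSubfield L)) L ⧸ relNormOneRat (↥(NumberField.maximalRealSubfield L)) L) Circle)
    (t : ↥(relNormOneInfUnits (↥(NumberField.maximalRealSubfield L)) L)) :
    unitaryLineCharInf L χ t =
      ((charOfUnitaryLineChar L χ ((UnitaryGroup.cmAdelicOneEquivRelNormOne L).symm (relNormOneInfToIdeles (↥(NumberField.maximalRealSubfield L)) L t)) : ℂˣ) : ℂ) :=
  rfl

/-- **`χ[u_t] = archWeight L (archType L χ) t`**: on the archimedean torus an automorphic character IS the typed weight of its type. -/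
theorem unitaryLineCharInf_eq_archWeight
    (χ : ContinuousMonoidHom (relNormOneIdeles (↥(NumberField.maximalRealSubfield L)) L ⧸ relNormOneRat (↥(NumberField.maximalRealSubfield L)) L) Circle) :
    unitaryLineCharInf L χ = archWeight L (UnitaryLineChar.archType L χ) := by
  ext t
  have h := (UnitaryLineChar.hasArchType_iff L χ _).1 (UnitaryLineChar.hasArchType_archType L χ) t
  rw [relNormOneInfToQuot_apply] at h
  rw [unitaryLineCharInf_apply, charOfUnitaryLineChar_apply, MulEquiv.apply_symm_apply, ← h]
  rfl

/-- hence continuous. -/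
theorem continuous_unitaryLineCharInf
    (χ : ContinuousMonoidHom (relNormOneIdeles (↥(NumberField.maximalRealSubfield L)) L ⧸ relNormOneRat (↥(NumberField.maximalRealSubfield L)) L) Circle) :
    Continuous (unitaryLineCharInf L χ) := by
  rw [unitaryLineCharInf_eq_archWeight]
  exact continuous_archWeight L _

/-- … and of type `archType L χ`. -/
theorem charArchType_unitaryLineCharInf
    (χ : ContinuousMonoidHom (relNormOneIdeles (↥(NumberField.maximalRealSubfield L)) L ⧸ relNormOneRat (↥(NumberField.maximalRealSubfield L)) L) Circle)
    (h : Continuous (unitaryLineCharInf L χ)) :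
    charArchType L (unitaryLineCharInf L χ) h = UnitaryLineChar.archType L χ := by
  rw [charArchType_eq_iff, unitaryLineCharInf_eq_archWeight]

end Generic

/-! ## §2 The four slots of the S pin: η-pull-backs, discrepancy pull-backs, the eigen-character as a hom -/

section Slots

variable {L : CMField} {ι₁ : L →+* ℂ} (V : HermSpace3 L ι₁) (S : StubTree.SeesawDatum L)
variable
  (hGR : (cmSplittingDatum (L : Type) finProdFinEquiv (frameD V) (frameD_real V) (frameD_ne V) (dW S) (dW_real S) (dW_ne S)).CompatibleSplitting)
  (hGR₀ : (cmSplittingDatum (L : Type) (e₁) (frameD V) (frameD_real V) (frameD_ne V) (lineVec (L : Type) (dW S 0))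
    (fun _ => dW_real S 0) (fun _ => dW_ne S 0)).CompatibleSplitting)
  (hGR₁ : (cmSplittingDatum (L : Type) (e₁) (frameD V) (frameD_real V) (frameD_ne V) (lineVec (L : Type) (dW S 1))
    (fun _ => dW_real S 1) (fun _ => dW_ne S 1)).CompatibleSplitting)
  (hGR₂ : (cmSplittingDatum (L : Type) (e₁) (frameD V) (frameD_real V) (frameD_ne V) (lineVec (L : Type) (dW' S 0))
    (fun _ => dW'_real S 0) (fun _ => dW'_ne S 0)).CompatibleSplitting)
  (hGR₃ : (cmSplittingDatum (L : Type) (e₁) (frameD V) (frameD_real V) (frameD_ne V) (lineVec (L : Type) (dW' S 1))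
    (fun _ => dW'_real S 1) (fun _ => dW'_ne S 1)).CompatibleSplitting)
  (η : CMAdelic (L : Type) (frameD V) × CMAdelic (L : Type) (dW S) →* ℂˣ)

/-- `t ↦ (1, u_t) ∈ U(V)(𝔸) × U(1)(𝔸)`. -/
def oneInfUnit : ↥(relNormOneInfUnits (↥(NumberField.maximalRealSubfield (L : Type))) (L : Type)) →*
    CMAdelic (L : Type) (frameD V) × CMAdelicOne (L : Type) :=
  (1 : _ →* CMAdelic (L : Type) (frameD V)).prod (infUnitToOne (L : Type))

/-- `t ↦ (1, u_t · 1_{⟨d⟩}) ∈ U(V)(𝔸) × U(⟨d⟩)(𝔸)`. -/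
def oneCenterInfUnit (d : (L : Type)) : ↥(relNormOneInfUnits (↥(NumberField.maximalRealSubfield (L : Type))) (L : Type)) →*
    CMAdelic (L : Type) (frameD V) × CMAdelic (L : Type) (lineVec (L : Type) d) :=
  (1 : _ →* CMAdelic (L : Type) (frameD V)).prod ((CMCenter (L : Type) (lineVec (L : Type) d)).comp (infUnitToOne (L : Type)))

/-- the four η-pull-backs `t ↦ ηₖ(1, u_t)` as homs into `ℂ`. -/
def etaInf (k : Fin 4) : ↥(relNormOneInfUnits (↥(NumberField.maximalRealSubfield (L : Type))) (L : Type)) →* ℂ :=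
  (Units.coeHom ℂ).comp ((![eta₀ V S η, eta₁ V S η, eta₂ V S η, eta₃ V S η] k).comp (oneInfUnit V))

/-- formula: `etaInf k t = ηₖ(1, u_t)`. -/
theorem etaInf_apply (k : Fin 4) (t : ↥(relNormOneInfUnits (↥(NumberField.maximalRealSubfield (L : Type))) (L : Type))) :
    etaInf V S η k t =
      (((![eta₀ V S η, eta₁ V S η, eta₂ V S η, eta₃ V S η] k)
        (1, (UnitaryGroup.cmAdelicOneEquivRelNormOne (L : Type)).symm (relNormOneInfToIdeles (↥(NumberField.maximalRealSubfield (L : Type))) (L : Type) t)) : ℂˣ) : ℂ) :=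
  rfl

/-- **the discrepancy pull-back of slot 0**: `t ↦ χ₀(1, u_t · 1_{W₀})`. -/
def slotChi₀ : ↥(relNormOneInfUnits (↥(NumberField.maximalRealSubfield (L : Type))) (L : Type)) →* ℂ :=
  (Units.coeHom ℂ).comp
    ((cmLineChar₀ (L : Type) finProdFinEquiv e₁ (frameD V) (frameD_real V) (frameD_ne V) (dW S) (dW_real S) (dW_ne S) hGR hGR₀ hGR₁).comp
      (oneCenterInfUnit V (dW S 0)))

/-- **slot 1**: `t ↦ χ₁(1, u_t · 1_{W₁})`. -/
def slotChi₁ : ↥(relNormOneInfUnits (↥(NumberField.maximalRealSubfield (L : Type))) (L : Type)) →* ℂ :=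
  (Units.coeHom ℂ).comp
    ((cmLineChar₁ (L : Type) finProdFinEquiv e₁ (frameD V) (frameD_real V) (frameD_ne V) (dW S) (dW_real S) (dW_ne S) hGR hGR₀ hGR₁).comp
      (oneCenterInfUnit V (dW S 1)))

/-- **slot 2** (conjugated plane): `t ↦ χ₂(1, u_t · 1_{W′₀})`. -/
def slotChi₂ : ↥(relNormOneInfUnits (↥(NumberField.maximalRealSubfield (L : Type))) (L : Type)) →* ℂ :=
  (Units.coeHom ℂ).comp
    ((cmConjLineChar₀ (L : Type) finProdFinEquiv e₁ (frameD V) (frameD_real V) (frameD_ne V) (dW S) (dW_real S) (dW_ne S)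
        (dW' S) (dW'_real S) (dW'_ne S) S.isoGL (isoGL_hg₀ S) hGR hGR₂ hGR₃).comp
      (oneCenterInfUnit V (dW' S 0)))

/-- **slot 3** (conjugated plane): `t ↦ χ₃(1, u_t · 1_{W′₁})`. -/
def slotChi₃ : ↥(relNormOneInfUnits (↥(NumberField.maximalRealSubfield (L : Type))) (L : Type)) →* ℂ :=
  (Units.coeHom ℂ).comp
    ((cmConjLineChar₁ (L : Type) finProdFinEquiv e₁ (frameD V) (frameD_real V) (frameD_ne V) (dW S) (dW_real S) (dW_ne S)
        (dW' S) (dW'_real S) (dW'_ne S) S.isoGL (isoGL_hg₀ S) hGR hGR₂ hGR₃).comp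
      (oneCenterInfUnit V (dW' S 1)))

/-- **(F1)'s centre eigenvalue `lineC` of the line `⟨d⟩` as a hom** (`χ_centre · ι_{w(v₁)}`). -/
def lineCHom (d : (L : Type)) (hd : NumberField.IsCMField.complexConj L d = d) (hd0 : d ≠ 0)
    (hGRd : (cmSplittingDatum (L : Type) (e₁) (frameD V) (frameD_real V) (frameD_ne V) (lineVec (L : Type) d)
      (fun _ => hd) (fun _ => hd0)).CompatibleSplitting) :
    ↥(relNormOneInfUnits (↥(NumberField.maximalRealSubfield (L : Type))) (L : Type)) →* ℂ :=
  Circle.coeHom.comp (lineCenterChar V d hd hd0 hGRd) *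
    (Circle.coeHom.comp (NumberField.archPlaceChar (L : Type) (cmPlaceOver (L : Type) (HypCensus.cmPlace (L : Type) ι₁)).1) :
      ↥(relNormOneInfUnits (↥(NumberField.maximalRealSubfield (L : Type))) (L : Type)) →* ℂ)

/-- `lineCHom … t = lineC … t` (definitional). -/
theorem lineCHom_apply (d : (L : Type)) (hd : NumberField.IsCMField.complexConj L d = d) (hd0 : d ≠ 0)
    (hGRd : (cmSplittingDatum (L : Type) (e₁) (frameD V) (frameD_real V) (frameD_ne V) (lineVec (L : Type) d)
      (fun _ => hd) (fun _ => hd0)).CompatibleSplitting)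
    (t : ↥(relNormOneInfUnits (↥(NumberField.maximalRealSubfield (L : Type))) (L : Type))) :
    lineCHom V d hd hd0 hGRd t = lineC V d hd hd0 hGRd t :=
  rfl

/-- `lineCHom` is continuous. -/
theorem continuous_lineCHom (d : (L : Type)) (hd : NumberField.IsCMField.complexConj L d = d) (hd0 : d ≠ 0)
    (hGRd : (cmSplittingDatum (L : Type) (e₁) (frameD V) (frameD_real V) (frameD_ne V) (lineVec (L : Type) d)
      (fun _ => hd) (fun _ => hd0)).CompatibleSplitting) :
    Continuous (lineCHom V d hd hd0 hGRd) :=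
  (continuous_subtype_val.comp (continuous_lineCenterChar V d hd hd0 hGRd)).mul
    (continuous_subtype_val.comp (NumberField.continuous_archPlaceChar (L : Type) _))

/-! ### `hμₖ ↔` a type identity -/

/-- **`hμ₀` IS an identity of integer vectors**: for any continuous eigen-character `c` of slot 0,
`(∀ t, η₀(1,u_t)·χ₀(1,u_t·1)·c t = archWeight (μ 0) t) ↔ charArchType (etaInf 0) + charArchType (slotChi₀ · c) = μ 0`. -/
theorem hμ₀_iff_charArchType (hη : Continuous (etaInf V S η 0)) (c : ↥(relNormOneInfUnits (↥(NumberField.maximalRealSubfield (L : Type))) (L : Type)) →* ℂ)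
    (hχc : Continuous ⇑(slotChi₀ V S hGR hGR₀ hGR₁ * c)) (m : NumberField.InfinitePlace (L : Type) → ℤ) :
    (∀ t : ↥(relNormOneInfUnits (↥(NumberField.maximalRealSubfield (L : Type))) (L : Type)),
      ((eta₀ V S η (1, (UnitaryGroup.cmAdelicOneEquivRelNormOne (L : Type)).symm (relNormOneInfToIdeles (↥(NumberField.maximalRealSubfield (L : Type))) (L : Type) t)) *
              cmLineChar₀ (L : Type) finProdFinEquiv e₁ (frameD V) (frameD_real V) (frameD_ne V) (dW S) (dW_real S) (dW_ne S)
                hGR hGR₀ hGR₁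
                (1, CMCenter (L : Type) (lineVec (L : Type) (dW S 0))
                  ((UnitaryGroup.cmAdelicOneEquivRelNormOne (L : Type)).symm (relNormOneInfToIdeles (↥(NumberField.maximalRealSubfield (L : Type))) (L : Type) t))) :
            ℂˣ) : ℂ) * c t =
        archWeight (L : Type) m t) ↔
      charArchType (L : Type) (etaInf V S η 0) hη + charArchType (L : Type) (slotChi₀ V S hGR hGR₀ hGR₁ * c) hχc = m := by
  rw [← charArchType_mul' (L : Type) _ _ hη hχc (hη.mul hχc),
    ← forall_mul_eq_archWeight_iff (L : Type) (etaInf V S η 0) (slotChi₀ V S hGR hGR₀ hGR₁ * c) (hη.mul hχc) m]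
  refine forall_congr' fun t => ?_
  rw [MonoidHom.mul_apply, Units.val_mul, mul_assoc]
  rfl

/-- **`hμ₁` IS an identity of integer vectors** (any continuous eigen-character `c` of slot 1). -/
theorem hμ₁_iff_charArchType (hη : Continuous (etaInf V S η 1)) (c : ↥(relNormOneInfUnits (↥(NumberField.maximalRealSubfield (L : Type))) (L : Type)) →* ℂ)
    (hχc : Continuous ⇑(slotChi₁ V S hGR hGR₀ hGR₁ * c)) (m : NumberField.InfinitePlace (L : Type) → ℤ) :
    (∀ t : ↥(relNormOneInfUnits (↥(NumberField.maximalRealSubfield (L : Type))) (L : Type)),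
      ((eta₁ V S η (1, ((UnitaryGroup.cmAdelicOneEquivRelNormOne (L : Type)).symm (relNormOneInfToIdeles (↥(NumberField.maximalRealSubfield (L : Type))) (L : Type) t))) *
              cmLineChar₁ (L : Type) finProdFinEquiv e₁ (frameD V) (frameD_real V) (frameD_ne V) (dW S) (dW_real S) (dW_ne S)
                hGR hGR₀ hGR₁
                (1, CMCenter (L : Type) (lineVec (L : Type) (dW S 1)) ((UnitaryGroup.cmAdelicOneEquivRelNormOne (L : Type)).symm (relNormOneInfToIdeles (↥(NumberField.maximalRealSubfield (L : Type))) (L : Type) t))) :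
            ℂˣ) : ℂ) * c t =
        archWeight (L : Type) m t) ↔
      charArchType (L : Type) (etaInf V S η 1) hη + charArchType (L : Type) (slotChi₁ V S hGR hGR₀ hGR₁ * c) hχc = m := by
  rw [← charArchType_mul' (L : Type) _ _ hη hχc (hη.mul hχc),
    ← forall_mul_eq_archWeight_iff (L : Type) (etaInf V S η 1) (slotChi₁ V S hGR hGR₀ hGR₁ * c) (hη.mul hχc) m]
  refine forall_congr' fun t => ?_
  rw [MonoidHom.mul_apply, Units.val_mul, mul_assoc]
  rfl

/-- **`hμ₂` IS an identity of integer vectors** (any continuous eigen-character `c` of slot 2). -/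
theorem hμ₂_iff_charArchType (hη : Continuous (etaInf V S η 2)) (c : ↥(relNormOneInfUnits (↥(NumberField.maximalRealSubfield (L : Type))) (L : Type)) →* ℂ)
    (hχc : Continuous ⇑(slotChi₂ V S hGR hGR₂ hGR₃ * c)) (m : NumberField.InfinitePlace (L : Type) → ℤ) :
    (∀ t : ↥(relNormOneInfUnits (↥(NumberField.maximalRealSubfield (L : Type))) (L : Type)),
      ((eta₂ V S η (1, ((UnitaryGroup.cmAdelicOneEquivRelNormOne (L : Type)).symm (relNormOneInfToIdeles (↥(NumberField.maximalRealSubfield (L : Type))) (L : Type) t))) *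
              cmConjLineChar₀ (L : Type) finProdFinEquiv e₁ (frameD V) (frameD_real V) (frameD_ne V) (dW S) (dW_real S) (dW_ne S)
                (dW' S) (dW'_real S) (dW'_ne S) S.isoGL (isoGL_hg₀ S) hGR hGR₂ hGR₃
                (1, CMCenter (L : Type) (lineVec (L : Type) (dW' S 0)) ((UnitaryGroup.cmAdelicOneEquivRelNormOne (L : Type)).symm (relNormOneInfToIdeles (↥(NumberField.maximalRealSubfield (L : Type))) (L : Type) t))) :
            ℂˣ) : ℂ) * c t =
        archWeight (L : Type) m t) ↔
      charArchType (L : Type) (etaInf V S η 2) hη + charArchType (L : Type) (slotChi₂ V S hGR hGR₂ hGR₃ * c) hχc = m := by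
  rw [← charArchType_mul' (L : Type) _ _ hη hχc (hη.mul hχc),
    ← forall_mul_eq_archWeight_iff (L : Type) (etaInf V S η 2) (slotChi₂ V S hGR hGR₂ hGR₃ * c) (hη.mul hχc) m]
  refine forall_congr' fun t => ?_
  rw [MonoidHom.mul_apply, Units.val_mul, mul_assoc]
  rfl

/-- **`hμ₃` IS an identity of integer vectors** (any continuous eigen-character `c` of slot 3). -/
theorem hμ₃_iff_charArchType (hη : Continuous (etaInf V S η 3)) (c : ↥(relNormOneInfUnits (↥(NumberField.maximalRealSubfield (L : Type))) (L : Type)) →* ℂ)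
    (hχc : Continuous ⇑(slotChi₃ V S hGR hGR₂ hGR₃ * c)) (m : NumberField.InfinitePlace (L : Type) → ℤ) :
    (∀ t : ↥(relNormOneInfUnits (↥(NumberField.maximalRealSubfield (L : Type))) (L : Type)),
      ((eta₃ V S η (1, ((UnitaryGroup.cmAdelicOneEquivRelNormOne (L : Type)).symm (relNormOneInfToIdeles (↥(NumberField.maximalRealSubfield (L : Type))) (L : Type) t))) *
              cmConjLineChar₁ (L : Type) finProdFinEquiv e₁ (frameD V) (frameD_real V) (frameD_ne V) (dW S) (dW_real S) (dW_ne S)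
                (dW' S) (dW'_real S) (dW'_ne S) S.isoGL (isoGL_hg₀ S) hGR hGR₂ hGR₃
                (1, CMCenter (L : Type) (lineVec (L : Type) (dW' S 1)) ((UnitaryGroup.cmAdelicOneEquivRelNormOne (L : Type)).symm (relNormOneInfToIdeles (↥(NumberField.maximalRealSubfield (L : Type))) (L : Type) t))) :
            ℂˣ) : ℂ) * c t =
        archWeight (L : Type) m t) ↔
      charArchType (L : Type) (etaInf V S η 3) hη + charArchType (L : Type) (slotChi₃ V S hGR hGR₂ hGR₃ * c) hχc = m := by
  rw [← charArchType_mul' (L : Type) _ _ hη hχc (hη.mul hχc),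
    ← forall_mul_eq_archWeight_iff (L : Type) (etaInf V S η 3) (slotChi₃ V S hGR hGR₂ hGR₃ * c) (hη.mul hχc) m]
  refine forall_congr' fun t => ?_
  rw [MonoidHom.mul_apply, Units.val_mul, mul_assoc]
  rfl

end Slots

/-! ## §3 At the Stage-B η of #1204: the η-factor has type `archType χW`; the READ-OFF `slotType`; `nWOf`; the Δ-identities -/

section StageB

variable
  (χV χW : ∀ {L : CMField} {ι₁ : L →+* ℂ} (_V : HermSpace3 L ι₁) (_c : SeesawCtx L),
    ContinuousMonoidHom (relNormOneIdeles (↥(NumberField.maximalRealSubfield (L : Type))) (L : Type) ⧸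
      relNormOneRat (↥(NumberField.maximalRealSubfield (L : Type))) (L : Type)) Circle)
variable {L : CMField} {ι₁ : L →+* ℂ} (V : HermSpace3 L ι₁) (c : SeesawCtx L)

/-- **at the Stage-B η every η-pull-back IS `χW` read on the archimedean torus** (#1204 `EtaChi.eta_one_apply`). -/
theorem etaInf_eq_unitaryLineCharInf (k : Fin 4) :
    etaInf V c.D (EtaChi.η @χV @χW V c) k = unitaryLineCharInf (L : Type) (χW V c) := by
  ext t
  rw [etaInf_apply, unitaryLineCharInf_apply, EtaChi.eta_one_apply]

/-- hence continuous … -/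
theorem continuous_etaInf_eta (k : Fin 4) : Continuous (etaInf V c.D (EtaChi.η @χV @χW V c) k) := by
  rw [etaInf_eq_unitaryLineCharInf]
  exact continuous_unitaryLineCharInf (L : Type) (χW V c)

/-- … of type `archType (χW V c)`. -/
theorem charArchType_etaInf_eta (k : Fin 4) (h : Continuous (etaInf V c.D (EtaChi.η @χV @χW V c) k)) :
    charArchType (L : Type) (etaInf V c.D (EtaChi.η @χV @χW V c) k) h = UnitaryLineChar.archType (L : Type) (χW V c) := by
  rw [charArchType_eq_iff, etaInf_eq_unitaryLineCharInf, unitaryLineCharInf_eq_archWeight]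

variable
  (hGR : (cmSplittingDatum (L : Type) finProdFinEquiv (frameD V) (frameD_real V) (frameD_ne V) (dW c.D) (dW_real c.D) (dW_ne c.D)).CompatibleSplitting)
  (hGR₀ : (cmSplittingDatum (L : Type) (e₁) (frameD V) (frameD_real V) (frameD_ne V) (lineVec (L : Type) (dW c.D 0))
    (fun _ => dW_real c.D 0) (fun _ => dW_ne c.D 0)).CompatibleSplitting)
  (hGR₁ : (cmSplittingDatum (L : Type) (e₁) (frameD V) (frameD_real V) (frameD_ne V) (lineVec (L : Type) (dW c.D 1))
    (fun _ => dW_real c.D 1) (fun _ => dW_ne c.D 1)).CompatibleSplitting)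
  (hGR₂ : (cmSplittingDatum (L : Type) (e₁) (frameD V) (frameD_real V) (frameD_ne V) (lineVec (L : Type) (dW' c.D 0))
    (fun _ => dW'_real c.D 0) (fun _ => dW'_ne c.D 0)).CompatibleSplitting)
  (hGR₃ : (cmSplittingDatum (L : Type) (e₁) (frameD V) (frameD_real V) (frameD_ne V) (lineVec (L : Type) (dW' c.D 1))
    (fun _ => dW'_real c.D 1) (fun _ => dW'_ne c.D 1)).CompatibleSplitting)

/-- **THE READ-OFF: the archimedean type of slot `k`'s (discrepancy · eigen) character** (`c` the slot's continuous eigen-character). -/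
def slotType (χc : ↥(relNormOneInfUnits (↥(NumberField.maximalRealSubfield (L : Type))) (L : Type)) →* ℂ) (hχc : Continuous χc) :
    NumberField.InfinitePlace (L : Type) → ℤ :=
  charArchType (L : Type) χc hχc

/-- defining property: `archWeight (slotType χc) = χc`. -/
theorem archWeight_slotType (χc : ↥(relNormOneInfUnits (↥(NumberField.maximalRealSubfield (L : Type))) (L : Type)) →* ℂ)
    (hχc : Continuous χc) : archWeight (L : Type) (slotType (L := L) χc hχc) = χc :=
  archWeight_charArchType (L : Type) χc hχc

/-- **`hμ₀` at the Stage-B η ↔ `archType (χW V c) + slotType (slotChi₀ · c₀) = μ 0`.** -/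
theorem hμ₀_iff_archType (c₀ : ↥(relNormOneInfUnits (↥(NumberField.maximalRealSubfield (L : Type))) (L : Type)) →* ℂ)
    (hχc : Continuous ⇑(slotChi₀ V c.D hGR hGR₀ hGR₁ * c₀)) (m : NumberField.InfinitePlace (L : Type) → ℤ) :
    (∀ t : ↥(relNormOneInfUnits (↥(NumberField.maximalRealSubfield (L : Type))) (L : Type)),
      ((eta₀ V c.D (EtaChi.η @χV @χW V c) (1, (UnitaryGroup.cmAdelicOneEquivRelNormOne (L : Type)).symm (relNormOneInfToIdeles (↥(NumberField.maximalRealSubfield (L : Type))) (L : Type) t)) *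
              cmLineChar₀ (L : Type) finProdFinEquiv e₁ (frameD V) (frameD_real V) (frameD_ne V) (dW c.D) (dW_real c.D) (dW_ne c.D)
                hGR hGR₀ hGR₁
                (1, CMCenter (L : Type) (lineVec (L : Type) (dW c.D 0))
                  ((UnitaryGroup.cmAdelicOneEquivRelNormOne (L : Type)).symm (relNormOneInfToIdeles (↥(NumberField.maximalRealSubfield (L : Type))) (L : Type) t))) :
            ℂˣ) : ℂ) * c₀ t =
        archWeight (L : Type) m t) ↔
      UnitaryLineChar.archType (L : Type) (χW V c) + slotType (L := L) (slotChi₀ V c.D hGR hGR₀ hGR₁ * c₀) hχc = m := by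
  rw [hμ₀_iff_charArchType V c.D hGR hGR₀ hGR₁ (EtaChi.η @χV @χW V c) (continuous_etaInf_eta χV χW V c 0) c₀ hχc m,
    charArchType_etaInf_eta]
  rfl

/-- **`hμ₁` at the Stage-B η ↔ `archType (χW V c) + slotType (slotChi₁ · c₁) = μ 1`.** -/
theorem hμ₁_iff_archType (c₁ : ↥(relNormOneInfUnits (↥(NumberField.maximalRealSubfield (L : Type))) (L : Type)) →* ℂ)
    (hχc : Continuous ⇑(slotChi₁ V c.D hGR hGR₀ hGR₁ * c₁)) (m : NumberField.InfinitePlace (L : Type) → ℤ) :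
    (∀ t : ↥(relNormOneInfUnits (↥(NumberField.maximalRealSubfield (L : Type))) (L : Type)),
      ((eta₁ V c.D (EtaChi.η @χV @χW V c) (1, (UnitaryGroup.cmAdelicOneEquivRelNormOne (L : Type)).symm (relNormOneInfToIdeles (↥(NumberField.maximalRealSubfield (L : Type))) (L : Type) t)) *
              cmLineChar₁ (L : Type) finProdFinEquiv e₁ (frameD V) (frameD_real V) (frameD_ne V) (dW c.D) (dW_real c.D) (dW_ne c.D)
                hGR hGR₀ hGR₁
                (1, CMCenter (L : Type) (lineVec (L : Type) (dW c.D 1))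
                  ((UnitaryGroup.cmAdelicOneEquivRelNormOne (L : Type)).symm (relNormOneInfToIdeles (↥(NumberField.maximalRealSubfield (L : Type))) (L : Type) t))) :
            ℂˣ) : ℂ) * c₁ t =
        archWeight (L : Type) m t) ↔
      UnitaryLineChar.archType (L : Type) (χW V c) + slotType (L := L) (slotChi₁ V c.D hGR hGR₀ hGR₁ * c₁) hχc = m := by
  rw [hμ₁_iff_charArchType V c.D hGR hGR₀ hGR₁ (EtaChi.η @χV @χW V c) (continuous_etaInf_eta χV χW V c 1) c₁ hχc m,
    charArchType_etaInf_eta]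
  rfl


-- port_pkg: scope closed for this part
end StageB
end HodgeCM.Model.ArchSideTerm
end
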